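import Mathlib.Topology.Homotopy.Lifting
import Mathlib.Topology.Algebra.Group.Quotient
import HarnessLib

/-!
# Naturality of the monodromy of a quotient covering; `π₁` of a torus `V/Λ` as the lattice, equivariantly (Hatcher, §1.1, §1.3)

Topic `Literature/AlgebraicTopology/FundamentalGroup`; companion of `QuotientCoveringConjugation.lean`.
Everything is PROVED from Mathlib's covering-space theory (`IsCoveringMap.liftPath`,
`monodromy_eq_of_map_eq`, `IsQuotientCoveringMap.fundamentalGroupToMulOpposite`,
`AddSubgroup.isAddQuotientCoveringMap_of_comm`); one small definition (`torusMap`), no named facts.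
Written for the topological half of Serre 1964 (`Literature/Barriers/HodgeConjecture/ConjugateVarietiesSerreTopologyProofs.lean`:
"les opérations de `G` sur `π₁(A_φ)` étant celles déduites de la structure de `S`-module de
`π₁(A_φ)`"), but general.

* `fundamentalGroupToMulOpposite_mapOfEq` (and `_add`) — **naturality of the monodromy
  homomorphism** `π₁(X, x) → Gᵐᵒᵖ` of a quotient covering `p : E → X = E/G`: if `φ̃ : E → E'` lies
  over `φ : X → X'` and is `τ`-equivariant (`φ̃ (g • z) = τ g • φ̃ z`), the monodromy of `φ_* γ` at
  `φ̃ e` is `τ` of the monodromy of `γ` at `e` (push the lift of `γ` forward by `φ̃`; Hatcher,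
  Prop. 1.39 and the lifting criterion Prop. 1.33);
* `torusMap Λ M` (definition) — the continuous self-map of `V/Λ` induced by an additive continuous
  `M : V → V` with `M Λ ⊆ Λ`; `torusMap_mk`;
* `fundamentalGroupToMulOpposite_torusMap` — for a discrete subgroup `Λ` of a commutative
  topological group `V` (so `V → V/Λ` is an additive quotient covering), the monodromy
  `π₁(V/Λ) → Λ` intertwines `(M̄)_*` with `M|_Λ`;
* `exists_mulEquiv_fundamentalGroup_torus` — for `V` moreover simply connected: given an additive
  group `N` with a self-map `θ` and `ε : N ≃ Λ` carrying `θ` to `M|_Λ`, an isomorphism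
  `j : N ≅ π₁(V/Λ, 0)` carrying `θ` to `(M̄)_*`, and `π₁(V/Λ, 0)` is abelian (Hatcher, Example 1.13:
  `π₁(T^n) ≅ ℤ^n`, here naturally in linear maps preserving the lattice);
* `mapOfEq_congr_map` — congruence of `FundamentalGroup.mapOfEq` in the map.

## References

* A. Hatcher, *Algebraic Topology*, CUP 2002: Example 1.13 (p. 34), Prop. 1.33 (p. 61),
  Prop. 1.39 (p. 71). [HatcherAT2002]
-/

noncomputable section

open scoped unitInterval

namespace Literature.AlgebraicTopology.FundamentalGroup

open IsQuotientCoveringMap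

variable {E X E' X' : Type*} [TopologicalSpace E] [TopologicalSpace X] [TopologicalSpace E']
  [TopologicalSpace X'] {G G' : Type*} [Group G] [MulAction G E] [Group G'] [MulAction G' E']
  {p : E → X} {p' : E' → X'}

/-- **Naturality of the monodromy homomorphism `π₁(X, x) → Gᵐᵒᵖ` of a quotient covering.**
If `φ̃ : E → E'` lies over `φ : X → X'` (`p' ∘ φ̃ = φ ∘ p`) and is `τ`-equivariant
(`φ̃ (g • z) = τ g • φ̃ z`), then the monodromy of `φ_* γ` at `φ̃ e` is `τ` of the monodromy of `γ`
at `e` (lift `γ` to `γ̃` from `e`; then `φ̃ ∘ γ̃` lifts `φ ∘ γ` from `φ̃ e` and ends at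
`φ̃ (g • e) = τ g • φ̃ e`). [folklore] -/
theorem fundamentalGroupToMulOpposite_mapOfEq (hp : IsQuotientCoveringMap p G)
    (hp' : IsQuotientCoveringMap p' G') (φt : C(E, E')) (φ : C(X, X')) (τ : G → G')
    (hover : ∀ z, p' (φt z) = φ (p z)) (hequiv : ∀ (g : G) (z : E), φt (g • z) = τ g • φt z)
    (e : E) {e' : E'} (he : φt e = e') (γ : FundamentalGroup X (p e)) :
    hp'.fundamentalGroupToMulOpposite ⟨e', rfl⟩
        (FundamentalGroup.mapOfEq φ (show φ (p e) = p' e' by rw [← hover, he]) γ) =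
      MulOpposite.op (τ (MulOpposite.unop (hp.fundamentalGroupToMulOpposite ⟨e, rfl⟩ γ))) := by
  subst he
  set g := MulOpposite.unop (hp.fundamentalGroupToMulOpposite ⟨e, rfl⟩ γ) with hg
  have hmono : (hp.isCoveringMap.monodromy γ ⟨e, rfl⟩ : E) = g • e := by
    rw [hg, unop_fundamentalGroupToMulOpposite_smul]
  rw [fundamentalGroupToMulOpposite_apply_eq_Iff, MulOpposite.unop_op]
  obtain ⟨c, rfl⟩ := Path.Homotopic.Quotient.mk_surjective γ
  -- the lift of `c` from `e` and its push-forward by `φ̃`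
  have h0 : c 0 = p e := c.source
  set L := hp.isCoveringMap.liftPath c e h0 with hL
  have hL1 : L 1 = g • e := by
    rw [← hmono]; rfl
  have hLlift : ∀ t, p (L t) = c t := fun t ↦ congrFun (hp.isCoveringMap.liftPath_lifts c e h0) t
  have hmem : τ g • φt e ∈ p' ⁻¹' {p' (φt e)} := by
    rw [Set.mem_preimage, Set.mem_singleton_iff, ← hequiv, hover, hover,
      hp.apply_eq_iff_mem_orbit.2 (MulAction.mem_orbit _ _)]
  let P : Path (φt e) (τ g • φt e) :=
    { toFun := fun t ↦ φt (L t)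
      continuous_toFun := φt.continuous.comp L.continuous
      source' := by simp only [hL, hp.isCoveringMap.liftPath_zero]
      target' := by simp only [hL1, hequiv] }
  have key : hp'.isCoveringMap.monodromy (FundamentalGroup.mapOfEq φ
      (show φ (p e) = p' (φt e) by rw [← hover])
      (Path.Homotopic.Quotient.mk c)) ⟨φt e, rfl⟩ = ⟨τ g • φt e, hmem⟩ := by
    refine hp'.isCoveringMap.monodromy_eq_of_map_eq (Γ := Path.Homotopic.Quotient.mk P) ?_
    rw [FundamentalGroup.mapOfEq_apply]
    change Path.Homotopic.Quotient.mk _ = Path.Homotopic.Quotient.mk _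
    congr 1
    ext t
    simp [P, hover, hLlift]
  change (τ g • φt e) = (hp'.isCoveringMap.monodromy _ ⟨φt e, rfl⟩ : E')
  rw [key]


/-- Additive version of `fundamentalGroupToMulOpposite_mapOfEq` (additive groups acting, e.g. a
lattice acting on a vector space by translations). [folklore] -/
theorem fundamentalGroupToMulOpposite_mapOfEq_add {G G' : Type*} [AddGroup G] [AddAction G E]
    [AddGroup G'] [AddAction G' E'] (hp : IsAddQuotientCoveringMap p G)
    (hp' : IsAddQuotientCoveringMap p' G') (φt : C(E, E')) (φ : C(X, X')) (τ : G → G')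
    (hover : ∀ z, p' (φt z) = φ (p z)) (hequiv : ∀ (g : G) (z : E), φt (g +ᵥ z) = τ g +ᵥ φt z)
    (e : E) {e' : E'} (he : φt e = e') (γ : FundamentalGroup X (p e)) :
    hp'.fundamentalGroupToMulOpposite ⟨e', rfl⟩
        (FundamentalGroup.mapOfEq φ (show φ (p e) = p' e' by rw [← hover, he]) γ) =
      MulOpposite.op (Multiplicative.ofAdd (τ (Multiplicative.toAdd
        (MulOpposite.unop (hp.fundamentalGroupToMulOpposite ⟨e, rfl⟩ γ))))) :=
  fundamentalGroupToMulOpposite_mapOfEq hp.toMultiplicative hp'.toMultiplicative φt φ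
    (fun g ↦ Multiplicative.ofAdd (τ g.toAdd)) hover (fun g z ↦ hequiv g.toAdd z) e he γ

section Torus

variable {V : Type*} [AddCommGroup V] [TopologicalSpace V]

/-- The map of tori `V/Λ → V/Λ` induced by an additive endomorphism `M` of `V` preserving the
lattice `Λ`, as a continuous map. [folklore] -/
def torusMap (Λ : AddSubgroup V) (M : V →+ V) (hMc : Continuous M) (hM : ∀ v ∈ Λ, M v ∈ Λ) :
    C(V ⧸ Λ, V ⧸ Λ) :=
  ⟨QuotientAddGroup.map Λ Λ M hM, by
    apply (QuotientAddGroup.isQuotientMap_mk Λ).continuous_iff.2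
    exact (QuotientAddGroup.continuous_mk).comp hMc⟩

/-- `torusMap Λ M` on a class `[v]` is `[M v]` (by construction). [folklore] -/
@[simp] theorem torusMap_mk (Λ : AddSubgroup V) (M : V →+ V) (hMc : Continuous M)
    (hM : ∀ v ∈ Λ, M v ∈ Λ) (v : V) :
    torusMap Λ M hMc hM (v : V ⧸ Λ) = (M v : V ⧸ Λ) := rfl

/-- **Equivariance of the monodromy of a torus.** For a discrete subgroup `Λ` of a commutative
topological group `V`, the projection `V → V/Λ` is an additive quotient covering (Mathlib
`AddSubgroup.isAddQuotientCoveringMap_of_comm`), and for an additive continuous `M : V → V`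
with `M Λ ⊆ Λ` the monodromy `π₁(V/Λ, [e]) → Λ` intertwines `(M̄)_*` (`M̄ : V/Λ → V/Λ` the
induced map) with `M|_Λ`: lifts of loops are pushed forward by `M`. In particular for `V` simply
connected (`π₁(V/Λ) ≅ Λ`), `(M̄)_*` "is" `M|_Λ` (Hatcher, §1.1, `π₁(T^n) ≅ ℤ^n` naturally).
[cite: HatcherAT2002, Example 1.13 and Prop. 1.39] -/
theorem fundamentalGroupToMulOpposite_torusMap [IsTopologicalAddGroup V] (Λ : AddSubgroup V)
    (hΛ : IsDiscrete (Λ : Set V))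
    (M : V →+ V) (hMc : Continuous M) (hM : ∀ v ∈ Λ, M v ∈ Λ) (e : V) {e' : V} (he : M e = e')
    (γ : FundamentalGroup (V ⧸ Λ) (e : V ⧸ Λ)) :
    (Λ.isAddQuotientCoveringMap_of_comm hΛ).fundamentalGroupToMulOpposite ⟨e', rfl⟩
        (FundamentalGroup.mapOfEq (torusMap Λ M hMc hM)
          (show torusMap Λ M hMc hM (e : V ⧸ Λ) = (e' : V ⧸ Λ) by rw [torusMap_mk, he]) γ) =
      MulOpposite.op (Multiplicative.ofAdd (⟨M ((Multiplicative.toAdd (MulOpposite.unop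
        ((Λ.isAddQuotientCoveringMap_of_comm hΛ).fundamentalGroupToMulOpposite ⟨e, rfl⟩ γ)) : Λ) : V),
          hM _ (SetLike.coe_mem _)⟩ : Λ)) :=
  fundamentalGroupToMulOpposite_mapOfEq_add (Λ.isAddQuotientCoveringMap_of_comm hΛ)
    (Λ.isAddQuotientCoveringMap_of_comm hΛ) ⟨M, hMc⟩ (torusMap Λ M hMc hM)
    (fun v ↦ ⟨M v, hM v v.2⟩) (fun z ↦ rfl) (fun g z ↦ by
      change M ((g : V) + z) = ((⟨M g, hM g g.2⟩ : Λ) : V) + M z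
      rw [map_add]) e he γ

end Torus


/-- Congruence of `FundamentalGroup.mapOfEq` in the (bundled) map. [folklore] -/
theorem mapOfEq_congr_map {X₀ Y₀ : Type*} [TopologicalSpace X₀] [TopologicalSpace Y₀]
    {f f' : C(X₀, Y₀)} (hff : f = f') {x : X₀} {y : Y₀} (h : f x = y) (h' : f' x = y)
    (γ : FundamentalGroup X₀ x) :
    FundamentalGroup.mapOfEq f h γ = FundamentalGroup.mapOfEq f' h' γ := by
  subst hff
  rfl

section TorusModel

variable {V : Type*} [AddCommGroup V] [TopologicalSpace V] [IsTopologicalAddGroup V]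
  [SimplyConnectedSpace V]

/-- **`π₁` of a torus `V/Λ` as a lattice, equivariantly.** For `V` a simply connected commutative
topological group, `Λ` a discrete subgroup and `M : V → V` additive continuous with `M Λ ⊆ Λ`:
given an additive group `N` with an endomorphism `θ` and an isomorphism `ε : N ≃ Λ` carrying `θ`
to `M|_Λ`, there is an isomorphism `j : N ≅ π₁(V/Λ, 0)` carrying `θ` to `(M̄)_*` (and `π₁(V/Λ, 0)`
is abelian).  (`j = Φ⁻¹ ∘ op ∘ ε` for Mathlib's monodromy isomorphism
`Φ : π₁(V/Λ, 0) ≅ (Multiplicative Λ)ᵐᵒᵖ`, `IsAddQuotientCoveringMap.fundamentalGroupEquiv`,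
and `fundamentalGroupToMulOpposite_torusMap`.)  For Serre 1964: `V/Λ = A_φ(ℂ)`,
`Λ = π₁(A_φ) ≅ e_φ S`, `N = S` or `𝔟S`, `θ = ζ`, `M̄` = the action of a generator of `G`.
[cite: HatcherAT2002, Example 1.13 and Prop. 1.39] -/
theorem exists_mulEquiv_fundamentalGroup_torus (Λ : AddSubgroup V) (hΛ : IsDiscrete (Λ : Set V))
    (M : V →+ V) (hMc : Continuous M) (hM : ∀ v ∈ Λ, M v ∈ Λ)
    {N : Type*} [AddCommGroup N] (θ : N → N) (ε : N ≃+ Λ)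
    (hε : ∀ n, ((ε (θ n) : Λ) : V) = M (ε n)) :
    ∃ j : Multiplicative N ≃* FundamentalGroup (V ⧸ Λ) ((0 : V) : V ⧸ Λ),
      (∀ n, FundamentalGroup.mapOfEq (torusMap Λ M hMc hM)
          (show torusMap Λ M hMc hM ((0 : V) : V ⧸ Λ) = ((0 : V) : V ⧸ Λ) by
            rw [torusMap_mk, map_zero]) (j (Multiplicative.ofAdd n)) =
        j (Multiplicative.ofAdd (θ n))) ∧
      ∀ u v : FundamentalGroup (V ⧸ Λ) ((0 : V) : V ⧸ Λ), u * v = v * u := by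
  set hp := Λ.isAddQuotientCoveringMap_of_comm hΛ with hpdef
  let Φ : FundamentalGroup (V ⧸ Λ) ((0 : V) : V ⧸ Λ) ≃* (Multiplicative Λ)ᵐᵒᵖ :=
    hp.fundamentalGroupEquiv ⟨0, rfl⟩
  have hΦ : ∀ γ, Φ γ = hp.fundamentalGroupToMulOpposite ⟨0, rfl⟩ γ := fun γ ↦ rfl
  let j : Multiplicative N ≃* FundamentalGroup (V ⧸ Λ) ((0 : V) : V ⧸ Λ) :=
    ((AddEquiv.toMultiplicative ε).trans (MulOpposite.opMulEquiv)).trans Φ.symm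
  have hjΦ : ∀ n, Φ (j (Multiplicative.ofAdd n)) =
      MulOpposite.op (Multiplicative.ofAdd (ε n)) := fun n ↦ Φ.apply_symm_apply _
  refine ⟨j, fun n ↦ Φ.injective ?_, fun u v ↦ Φ.injective ?_⟩
  · rw [hjΦ, hΦ, fundamentalGroupToMulOpposite_torusMap Λ hΛ M hMc hM 0 (map_zero M), ← hΦ, hjΦ]
    simp only [MulOpposite.unop_op, toAdd_ofAdd, MulOpposite.op_inj]
    congr 1
    exact Subtype.ext (hε n).symm
  · rw [map_mul, map_mul, mul_comm]

end TorusModel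

end Literature.AlgebraicTopology.FundamentalGroup

end
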